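import Mathlib
import Summits.Ventures.HodgeRepro.Tier4.Line1.RTFSetting
import Summits.Ventures.HodgeRepro.Tier4.Line1.KernelSupportFinite
import Summits.Ventures.HodgeRepro.Tier4.Line1.KernelUnfold
import Summits.Ventures.HodgeRepro.Tier4.Line1.KernelOperator
import Summits.Ventures.HodgeRepro.Tier4.Line1.KernelEigen
import Summits.Ventures.HodgeRepro.Tier4.Line1.KernelNondegenerate
import Summits.Ventures.HodgeRepro.Tier4.Line1.InnerCalculus
import Summits.Ventures.HodgeRepro.Tier4.Line1.InnerBridge
import Summits.Ventures.HodgeRepro.Tier4.Line1.KernelAdjointInner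
import Summits.Ventures.HodgeRepro.Tier4.Line1.OrthComplement
import Summits.Ventures.HodgeRepro.Tier4.Line1.MaximalFamily

/-!
# Tier4/Line1/AdaptedONBGlue — the J1 glue: rungs (4b) + non-finite-dimensionality ⇒ an adapted ONB

Blind re-derivation cell `pub-hodge-repro`, Tier 4 «prove the step» (README §9–§10), seat t4-L4-p1 (cross-line J1 glue,
lead S12599 / S12632; signature as posted S12611).  Tree path `lean/Summits/Ventures/HodgeRepro/Tier4/Line1/AdaptedONBGlue.lean`.

WHAT IS PROVED.  `exists_adaptedONB_of_rungs`: for any `S : Setting G` over a second-countable locally compact `G`, IF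
`L²(DG)` is not finite-dimensional (`hinf`; a finite group without it is a counterexample — an infinite orthonormal
family cannot exist) and IF rung (4b) holds (`h4b`, displayed: every non-zero relatively closed invariant subspace
contains a non-zero irreducible invariant subspace — the landed `exists_irreducible_invariant_subspace_of_nondegenerate`
composed with the landed (4a) `kernelOp_nondegenerate` has exactly this shape), THEN there are `τ φ n` with
`S.IsAdaptedONB τ φ n`.  Assembly: a maximal orthogonal family of non-zero irreducible invariant subspaces
(`MaximalFamily`, Zorn) spans `L²(DG)` (`ae_eq_zero_of_orth_maximal`), is countable and is enumerated with `{0}`-padding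
(`exists_enumeration_orthFamily`); inside each `τ m` a countable dense set of `L²`-classes of members is Gram–Schmidt-orthonormalised
(`gramSchmidtNormed`), the non-zero vectors pulled back to members of `τ m` (`mem_clsSet_of_mem_span`); the set of
non-zero vectors is infinite by `hinf` (`infinite_of_not_finiteDimensional`) and is listed by `Denumerable`.

HC_CM is NOT proved by anyone in this repository.
-/

set_option autoImplicit false

noncomputable section

namespace Summit.Ventures.HodgeRepro.Tier4.Line1

open MeasureTheory Topology
open scoped ComplexConjugate InnerProductSpace

namespace RTF

variable {G : Type} [Group G] [TopologicalSpace G] [IsTopologicalGroup G] [MeasurableSpace G]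
  [BorelSpace G]

namespace Setting

variable (S : Setting G)

/-- The `L²(DG)`-classes of the continuous members of `V`. -/
def clsSet (V : Set (G → ℂ)) : Set (Lp ℂ 2 (S.μ.restrict S.DG)) :=
  {u | ∃ ψ ∈ V, ∃ h : Continuous ψ, u = S.toL2 h}

omit [IsTopologicalGroup G] in
/-- Every non-zero element of the span of `clsSet V` is the class of a member of `V`. -/
theorem mem_clsSet_of_mem_span {V : Set (G → ℂ)} (hV : S.IsInvariantSubspace V)
    {u : Lp ℂ 2 (S.μ.restrict S.DG)} (hu : u ∈ Submodule.span ℂ (S.clsSet V)) (hne : u ≠ 0) : u ∈ S.clsSet V := by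
  have key : ∀ u ∈ Submodule.span ℂ (S.clsSet V), u = 0 ∨ u ∈ S.clsSet V := by
    intro u hu
    refine Submodule.span_induction (p := fun u _ => u = 0 ∨ u ∈ S.clsSet V) (fun x hx => Or.inr hx)
      (Or.inl rfl) ?_ ?_ hu
    · rintro x y _ _ (rfl | ⟨ψ, hψ, hc, rfl⟩) (rfl | ⟨φ, hφ, hc', rfl⟩)
      · left
        simp
      · right
        rw [zero_add]
        exact ⟨φ, hφ, hc', rfl⟩
      · right
        rw [add_zero]
        exact ⟨ψ, hψ, hc, rfl⟩
      · right
        exact ⟨fun x => ψ x + φ x, hV.add ψ hψ φ hφ, hc.add hc', (S.toL2_add hc hc').symm⟩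
    · rintro a x _ (rfl | ⟨ψ, hψ, hc, rfl⟩)
      · left
        simp
      · right
        exact ⟨fun x => a * ψ x, hV.smul ψ hψ a, continuous_const.mul hc, (S.toL2_smul hc a).symm⟩
  exact (key u hu).resolve_left hne

omit [IsTopologicalGroup G] in
/-- `clsSet V` has a countable subset in whose closure it lies (`L²(DG)` is second countable). -/
theorem exists_countable_dense_clsSet [SecondCountableTopology G] (V : Set (G → ℂ)) :
    ∃ c : Set (Lp ℂ 2 (S.μ.restrict S.DG)), c ⊆ S.clsSet V ∧ c.Countable ∧ S.clsSet V ⊆ closure c := by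
  haveI := S.isFiniteMeasure_restrict_DG
  haveI : Fact ((2 : ENNReal) ≠ ⊤) := ⟨ENNReal.ofNat_ne_top⟩
  obtain ⟨t, htc, htd⟩ := TopologicalSpace.exists_countable_dense (↥(S.clsSet V))
  exact ⟨Subtype.val '' t, Subtype.coe_image_subset _ _, htc.image _, Subtype.dense_iff.1 htd⟩

omit [IsTopologicalGroup G] in
/-- **Gram–Schmidt inside `V`**: a sequence `g` of `L²(DG)`-vectors whose non-zero terms are classes of members of `V`,
pairwise orthonormal, and which is total for `clsSet V`: a vector orthogonal to every `g k` is orthogonal to `clsSet V`. -/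
theorem exists_gramSchmidt [SecondCountableTopology G] {V : Set (G → ℂ)} (hV : S.IsInvariantSubspace V) :
    ∃ g : ℕ → Lp ℂ 2 (S.μ.restrict S.DG),
      (∀ k, g k ≠ 0 → g k ∈ S.clsSet V) ∧
      (∀ k k', g k ≠ 0 → g k' ≠ 0 → ⟪g k, g k'⟫_ℂ = if k = k' then 1 else 0) ∧
      ∀ u ∈ S.clsSet V, ∀ w : Lp ℂ 2 (S.μ.restrict S.DG), (∀ k, ⟪g k, w⟫_ℂ = 0) → ⟪u, w⟫_ℂ = 0 := by
  obtain ⟨c, hcsub, hcc, hcd⟩ := S.exists_countable_dense_clsSet V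
  obtain ⟨e, he⟩ := (hcc.insert (0 : Lp ℂ 2 (S.μ.restrict S.DG))).exists_eq_range ⟨0, Set.mem_insert _ _⟩
  set g : ℕ → Lp ℂ 2 (S.μ.restrict S.DG) := InnerProductSpace.gramSchmidtNormed ℂ e with hg
  have hspan : Submodule.span ℂ (Set.range g) = Submodule.span ℂ c := by
    rw [hg, InnerProductSpace.span_gramSchmidtNormed_range, InnerProductSpace.span_gramSchmidt, ← he,
      Submodule.span_insert_zero]
  refine ⟨g, fun k hk => ?_, fun k k' hk hk' => ?_, fun u hu w hw => ?_⟩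
  · apply S.mem_clsSet_of_mem_span hV _ hk
    have : g k ∈ Submodule.span ℂ (Set.range g) := Submodule.subset_span (Set.mem_range_self k)
    rw [hspan] at this
    exact Submodule.span_mono hcsub this
  · have horth := orthonormal_iff_ite.1 (InnerProductSpace.gramSchmidtNormed_orthonormal' (𝕜 := ℂ) e)
      (⟨k, hk⟩ : {i | InnerProductSpace.gramSchmidtNormed ℂ e i ≠ 0})
      (⟨k', hk'⟩ : {i | InnerProductSpace.gramSchmidtNormed ℂ e i ≠ 0})
    simp only [Subtype.mk.injEq] at horth
    exact horth
  · -- the orthogonal complement of `w` is closed and contains every `g k`, hence the closure of `c`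
    have hK : IsClosed ((Submodule.span ℂ {w})ᗮ : Set (Lp ℂ 2 (S.μ.restrict S.DG))) :=
      Submodule.isClosed_orthogonal _
    have hsub : (Submodule.span ℂ (Set.range g) : Set (Lp ℂ 2 (S.μ.restrict S.DG))) ⊆
        ((Submodule.span ℂ {w})ᗮ : Set (Lp ℂ 2 (S.μ.restrict S.DG))) := by
      intro v hv
      have : Submodule.span ℂ (Set.range g) ≤ (Submodule.span ℂ {w})ᗮ := by
        rw [Submodule.span_le]
        rintro _ ⟨k, rfl⟩
        exact Submodule.mem_orthogonal_singleton_iff_inner_right.2 (inner_eq_zero_symm.1 (hw k))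
      exact this hv
    have hcl : closure c ⊆ ((Submodule.span ℂ {w})ᗮ : Set (Lp ℂ 2 (S.μ.restrict S.DG))) := by
      rw [hK.closure_subset_iff]
      refine Set.Subset.trans ?_ hsub
      rw [hspan]
      exact Submodule.subset_span
    have : u ∈ (Submodule.span ℂ {w})ᗮ := hcl (hcd hu)
    exact inner_eq_zero_symm.1 (Submodule.mem_orthogonal_singleton_iff_inner_right.1 this)

omit [IsTopologicalGroup G] [BorelSpace G] in
/-- If the `L²(DG)`-vectors `v p`, `p ∈ P`, are total (a vector orthogonal to all of them is zero) and `L²(DG)` is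
not finite-dimensional, then `P` is infinite. -/
theorem infinite_of_total {ι : Type} {P : Set ι} {v : ι → Lp ℂ 2 (S.μ.restrict S.DG)}
    (hinf : ¬ FiniteDimensional ℂ (Lp ℂ 2 (S.μ.restrict S.DG)))
    (htotal : ∀ w : Lp ℂ 2 (S.μ.restrict S.DG), (∀ p ∈ P, ⟪v p, w⟫_ℂ = 0) → w = 0) : P.Infinite := by
  intro hfin
  apply hinf
  haveI := S.isFiniteMeasure_restrict_DG
  haveI : Fact ((2 : ENNReal) ≠ ⊤) := ⟨ENNReal.ofNat_ne_top⟩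
  let K : Submodule ℂ (Lp ℂ 2 (S.μ.restrict S.DG)) := Submodule.span ℂ (v '' P)
  haveI : FiniteDimensional ℂ K := FiniteDimensional.span_of_finite ℂ (hfin.image v)
  have hK : Kᗮ = ⊥ := by
    rw [Submodule.eq_bot_iff]
    intro w hw
    apply htotal w
    intro p hp
    exact (Submodule.mem_orthogonal K w).1 hw _ (Submodule.subset_span ⟨p, hp, rfl⟩)
  have hK' : K = ⊤ := Submodule.orthogonal_eq_bot_iff.1 hK
  have : FiniteDimensional ℂ (⊤ : Submodule ℂ (Lp ℂ 2 (S.μ.restrict S.DG))) := hK' ▸ inferInstance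
  exact (Submodule.topEquiv (R := ℂ) (M := Lp ℂ 2 (S.μ.restrict S.DG))).finiteDimensional

/-- **The J1 glue** (lead S12599/S12632, signature S12611): rung (4b) displayed as `h4b`, `L²(DG)` not
finite-dimensional (`hinf`), `G` second countable and locally compact ⇒ an adapted orthonormal basis exists. -/
theorem exists_adaptedONB_of_rungs [SecondCountableTopology G] [LocallyCompactSpace G]
    (hinf : ¬ FiniteDimensional ℂ (Lp ℂ 2 (S.μ.restrict S.DG)))
    (h4b : ∀ V : Set (G → ℂ), S.IsInvariantSubspace V →
      (∀ ψ : G → ℂ, Continuous ψ → S.Invariant ψ →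
        (∀ ε : ℝ, 0 < ε → ∃ ψ' ∈ V,
          eLpNorm (fun x => ψ x - ψ' x) 2 (S.μ.restrict S.DG) < ENNReal.ofReal ε) → ψ ∈ V) →
      (∃ ψ ∈ V, ∃ x, ψ x ≠ 0) →
      ∃ V' : Set (G → ℂ), S.IsInvariantSubspace V' ∧ V' ⊆ V ∧ S.IsIrreducible V' ∧ ∃ ψ ∈ V', ∃ x, ψ x ≠ 0) :
    ∃ (τ : ℕ → Set (G → ℂ)) (φ : ℕ → G → ℂ) (n : ℕ → ℕ), S.IsAdaptedONB τ φ n := by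
  classical
  obtain ⟨F, hF, hmax⟩ := S.exists_maximal_orthFamily
  obtain ⟨τ, hinv, hirr, horthSub, -, hall⟩ := S.exists_enumeration_orthFamily hF
  choose g hg_mem hg_orth hg_dense using fun m => S.exists_gramSchmidt (hinv m)
  -- orthonormality across the whole doubly-indexed family
  have key : ∀ p q : ℕ × ℕ, g p.1 p.2 ≠ 0 → g q.1 q.2 ≠ 0 →
      ⟪g p.1 p.2, g q.1 q.2⟫_ℂ = if p = q then 1 else 0 := by
    rintro ⟨m, k⟩ ⟨m', k'⟩ hp hq
    by_cases hm : m = m'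
    · subst hm
      rw [hg_orth m k k' hp hq]
      simp only [Prod.mk.injEq, true_and]
    · rw [if_neg (fun h => hm (Prod.mk.injEq _ _ _ _ ▸ h).1)]
      obtain ⟨ψ, hψ, hc, hψeq⟩ := hg_mem _ _ hp
      obtain ⟨ψ', hψ', hc', hψ'eq⟩ := hg_mem _ _ hq
      simp only at hψeq hψ'eq
      rw [hψeq, hψ'eq, ← S.inner_eq_inner_toL2 hc' hc]
      exact horthSub m' m (Ne.symm hm) ψ' hψ' ψ hψ
  -- totality of the doubly-indexed family
  have htotal : ∀ w : Lp ℂ 2 (S.μ.restrict S.DG),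
      (∀ p ∈ {p : ℕ × ℕ | g p.1 p.2 ≠ 0}, ⟪g p.1 p.2, w⟫_ℂ = 0) → w = 0 := by
    intro w hw
    have hw' : ∀ m k, ⟪g m k, w⟫_ℂ = 0 := fun m k => by
      by_cases h : g m k = 0
      · rw [h, _root_.inner_zero_left]
      · exact hw (m, k) h
    have horth : ∀ V ∈ F, ∀ ψ ∈ V, S.inner w ψ = 0 := by
      intro V hV ψ hψ
      obtain ⟨m, hm⟩ := hall V hV
      rw [← hm] at hψ
      have hc : Continuous ψ := (hinv m).cont ψ hψ
      have h0 : ⟪S.toL2 hc, w⟫_ℂ = 0 := hg_dense m _ ⟨ψ, hψ, hc, rfl⟩ w (hw' m)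
      rw [S.inner_eq_inner_toLp (Lp.memLp w) (S.memLp_restrict_of_continuous hc), Lp.toLp_coeFn]
      exact h0
    exact Lp.eq_zero_iff_ae_eq_zero.2 (S.ae_eq_zero_of_orth_maximal h4b hF hmax (Lp.memLp w) horth)
  -- the index set of the non-zero vectors is infinite, hence in bijection with `ℕ`
  set P : Set (ℕ × ℕ) := {p : ℕ × ℕ | g p.1 p.2 ≠ 0} with hP
  have hPinf : P.Infinite := S.infinite_of_total hinf htotal
  haveI : Infinite ↥P := hPinf.to_subtype
  obtain ⟨hden⟩ := nonempty_denumerable ↥P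
  let e : ℕ ≃ ↥P := (Denumerable.eqv ↥P).symm
  let idx : ℕ → ℕ × ℕ := fun j => ((e j : ↥P) : ℕ × ℕ)
  have hidx : ∀ j, g (idx j).1 (idx j).2 ≠ 0 := fun j => (e j).2
  have hidx_inj : Function.Injective idx := fun j j' h => e.injective (Subtype.ext h)
  have hidx_surj : ∀ p ∈ P, ∃ j, idx j = p := fun p hp => ⟨e.symm ⟨p, hp⟩, by simp [idx]⟩
  -- pull the non-zero vectors back to members of the subspaces
  have hchoose : ∀ j : ℕ, ∃ ψ : G → ℂ, ψ ∈ τ (idx j).1 ∧ ∃ hc : Continuous ψ,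
      S.toL2 hc = g (idx j).1 (idx j).2 := by
    intro j
    obtain ⟨ψ, hψ, hc, h⟩ := hg_mem _ _ (hidx j)
    exact ⟨ψ, hψ, hc, h.symm⟩
  choose φ hφmem hφc hφeq using hchoose
  refine ⟨τ, φ, fun j => (idx j).1, ⟨hinv, hirr, horthSub, hφmem, fun j j' => ?_, fun ψ hψ hperp => ?_⟩⟩
  · -- orthonormality
    rw [S.inner_eq_inner_toL2 (hφc j) (hφc j'), hφeq j', hφeq j, key _ _ (hidx j') (hidx j)]
    by_cases h : j = j'
    · subst h
      simp
    · rw [if_neg (fun h' => h (hidx_inj h').symm), if_neg h]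
  · -- completeness
    have hw : ∀ p ∈ P, ⟪g p.1 p.2, hψ.toLp ψ⟫_ℂ = 0 := by
      intro p hp
      obtain ⟨j, hj⟩ := hidx_surj p hp
      have h1 := hperp j
      rw [S.inner_eq_inner_toLp hψ (S.memLp_restrict_of_continuous (hφc j))] at h1
      have h2 : S.toL2 (hφc j) = (S.memLp_restrict_of_continuous (hφc j)).toLp (φ j) := rfl
      rw [← h2, hφeq j, hj] at h1
      exact h1
    have h0 : hψ.toLp ψ = 0 := htotal _ hw
    have hcoe := hψ.coeFn_toLp
    rw [h0] at hcoe
    exact hcoe.symm.trans (Lp.coeFn_zero ℂ 2 (S.μ.restrict S.DG))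

end Setting

end RTF

end Summit.Ventures.HodgeRepro.Tier4.Line1

end
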